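import Summits.MatrixMultiplication.MatrixMultiplication.Theorems.FarEdgeDescentFloorDial
import Summits.MatrixMultiplication.MatrixMultiplication.Theorems.FarEdgeDescentTreeCapThreeHalves

/-!
# Far-edge descent, kernel XLI-D — the bridge: every admissible floor-dial schedule (kernel XL-D) over heavy bases is a product tree of kernel XLI, so at `β = 3/2` the dial is capped at Schönhage's order on ALL schedules

Kernel XL-D (`FarEdgeDescentFloorDial`) typed the object of critique g19's ASKS (i): schedules
`Sched` (binary trees of dial products over bases `b`), their anchor / width profile / leg mass /
share / deviation / log-size, the node floors `FloorOK` and `Admissible`.  Kernel XLI-A/B/C proved the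
cap on the abstract product trees `PTree`.  This file is the DICTIONARY between the two:
* `toPTree β y₀ : Sched → PTree` (base `b ↦` leaf with share `1/(b+β)`, deviation `y₀ b`, size
  `log(b+β)`), and the identities `toPTree_share`, `toPTree_wide`, `toPTree_dev`, `toPTree_size`:
  the tree's share / deviation / size ARE the schedule's, and the tree's wide share is
  `T₂/(Q+βL)` with `T₂ = tailMass β s 2 = L − N` the leg mass at widths `≥ a²` — because the width-`a`
  leg mass `N = (profile β s).coeff 1` obeys `N_P = Q·N' + Q'·N` (`narrowMass_node`; profiles have no
  constant term, `profile_coeff_zero`);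
* `toPTree_adm`: an admissible schedule with `a ≥ 1`, heavy bases (`b ≥ β − 1`, `HeavyBases`), base
  deviations `0 ≤ y₀ b ≤ R/(b+β)` and `β ≤ (1 − V_min)(2 − a^{-2})` maps to an admissible tree of
  XLI-A with floor `V_min` and `ℓ_min = log(2β−1)` (the depth-2 node floor `(2 − a^{-2})·T₂ ≤ β·L` is
  exactly `w ≤ (1−V_min)·λ`);
* `sched_cap_three_halves`: at `β = 3/2` and any `a ≥ 2` (`V_min = 1/7`), for every admissible
  schedule over heavy bases, `dev (3/2) y₀ s ≤ (101/2)·R/(log 2)^{κ_S} · logSize (3/2) s ^ κ_S`,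
  `κ_S = log₂(4/3)` — the typed text of ASKS (i) (docstring of XL-D) for the β = 3/2 dial, heavy bases.

HONEST FRAMING: MODEL level (the dial bookkeeping of XXXVIII–XL as real-labelled trees); heavy bases
only (`b ≥ 1/2`; light bases change the share window, memo NODE-g61 §3); nothing about tensors,
`ω(1,k,1)` or `AnchoredLogConvexity`; no `sorry`, no axioms.  References: kernels XL-D, XLI-A/B/C;
Schönhage 1981 [Schonhage1981]; Coppersmith–Winograd 1982 [CoppersmithWinograd1982].
-/

noncomputable section

set_option linter.dupNamespace false

namespace Summit.MatrixMultiplication.MatrixMultiplication.Theorems.FarEdgeDescentTreeCapBridge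

open Polynomial Finset
open Summit.MatrixMultiplication.MatrixMultiplication.Theorems.FarEdgeDescentFloorDial
open Summit.MatrixMultiplication.MatrixMultiplication.Theorems.FarEdgeDescentTreeCap
open Summit.MatrixMultiplication.MatrixMultiplication.Theorems.FarEdgeDescentTreeCapThreeHalves

/-! ## The map and the heavy-base predicate -/

/-- The product tree of a schedule: a base `b` becomes a leaf with share `1/(b+β)`, deviation
`y₀ b` and size `log(b+β)`. -/
def toPTree (β : ℝ) (y₀ : ℝ → ℝ) : Sched → PTree
  | Sched.base b => PTree.leaf (1 / (b + β)) (y₀ b) (Real.log (b + β))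
  | Sched.node s t => PTree.node (toPTree β y₀ s) (toPTree β y₀ t)

/-- All bases are heavy: `b ≥ β − 1` (share `≤ 1/(2β−1)`). -/
def HeavyBases (β : ℝ) : Sched → Prop
  | Sched.base b => β - 1 ≤ b
  | Sched.node s t => HeavyBases β s ∧ HeavyBases β t

/-! ## Width-`a` leg mass -/

/-- Profiles have no constant term (no leg of width `a⁰`). -/
theorem profile_coeff_zero (β : ℝ) : ∀ s : Sched, (Sched.profile β s).coeff 0 = 0
  | Sched.base b => by simp [Sched.profile, Sched.qp]
  | Sched.node s t => by
      rw [(qp_node β s t).2, coeff_add, coeff_add, coeff_C_mul, coeff_C_mul, mul_coeff_zero,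
        profile_coeff_zero β s, profile_coeff_zero β t]
      ring

/-- The width-`a` leg mass of a product: `N_P = Q·N' + Q'·N`. -/
theorem narrowMass_node (β : ℝ) (s t : Sched) :
    (Sched.profile β (Sched.node s t)).coeff 1 =
      Sched.anchor β s * (Sched.profile β t).coeff 1 +
        Sched.anchor β t * (Sched.profile β s).coeff 1 := by
  have hmul : (Sched.profile β s * Sched.profile β t).coeff 1 = 0 := by
    rw [coeff_mul, Finset.Nat.sum_antidiagonal_eq_sum_range_succ_mk, Finset.sum_range_succ,
      Finset.sum_range_succ, Finset.sum_range_zero]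
    simp [profile_coeff_zero]
  rw [(qp_node β s t).2, coeff_add, coeff_add, coeff_C_mul, coeff_C_mul, hmul]
  ring

/-- `T₂ = L − N`. -/
theorem tailMass_two (β : ℝ) (s : Sched) :
    Sched.tailMass β s 2 = Sched.legMass β s - (Sched.profile β s).coeff 1 := by
  simp [Sched.tailMass, Finset.sum_range_succ, profile_coeff_zero]

/-! ## Positivity -/

/-- Anchors are nonnegative and leg masses positive along admissible schedules (`β ≥ 1`). -/
theorem anchor_nonneg_legMass_pos {a β : ℝ} (hβ : 1 ≤ β) :
    ∀ s : Sched, Sched.Admissible a β s → 0 ≤ Sched.anchor β s ∧ 0 < Sched.legMass β s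
  | Sched.base b, h => by
      refine ⟨?_, by rw [legMass_base]; norm_num⟩
      show 0 ≤ (Sched.qp β (Sched.base b)).1
      simp [Sched.qp]; exact h.1
  | Sched.node s t, h => by
      obtain ⟨hqs, hls⟩ := anchor_nonneg_legMass_pos hβ s h.1
      obtain ⟨hqt, hlt⟩ := anchor_nonneg_legMass_pos hβ t h.2.1
      rw [(qp_node β s t).1, legMass_node]
      refine ⟨?_, ?_⟩
      · have : 0 ≤ β * (β - 1) * Sched.legMass β s * Sched.legMass β t := by
          have := mul_nonneg (by linarith : (0:ℝ) ≤ β) (by linarith : (0:ℝ) ≤ β - 1)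
          positivity
        positivity
      · positivity

/-- The size proxy `Q + βL` is positive along admissible schedules. -/
theorem r_pos {a β : ℝ} (hβ : 1 ≤ β) (s : Sched) (h : Sched.Admissible a β s) :
    0 < Sched.anchor β s + β * Sched.legMass β s := by
  obtain ⟨hq, hl⟩ := anchor_nonneg_legMass_pos hβ s h
  have : 0 < β * Sched.legMass β s := mul_pos (by linarith) hl
  linarith

/-! ## The dictionary -/

/-- The tree's share is the schedule's share. -/
theorem toPTree_share {a β : ℝ} (hβ : 1 ≤ β) (y₀ : ℝ → ℝ) :
    ∀ s : Sched, Sched.Admissible a β s → PTree.share β (toPTree β y₀ s) = Sched.share β s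
  | Sched.base b, _ => by simp [toPTree, PTree.share, share_base]
  | Sched.node s t, h => by
      simp only [toPTree, PTree.share]
      rw [toPTree_share hβ y₀ s h.1, toPTree_share hβ y₀ t h.2.1,
        share_node (r_pos hβ s h.1).ne' (r_pos hβ t h.2.1).ne']

/-- The tree's wide share is `T₂/(Q + βL)`. -/
theorem toPTree_wide {a β : ℝ} (hβ : 1 ≤ β) (y₀ : ℝ → ℝ) :
    ∀ s : Sched, Sched.Admissible a β s →
      PTree.wide β (toPTree β y₀ s) =
        Sched.tailMass β s 2 / (Sched.anchor β s + β * Sched.legMass β s)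
  | Sched.base b, _ => by
      simp [toPTree, PTree.wide, tailMass_base_of_two_le]
  | Sched.node s t, h => by
      simp only [toPTree, PTree.wide]
      rw [toPTree_wide hβ y₀ s h.1, toPTree_wide hβ y₀ t h.2.1, toPTree_share hβ y₀ s h.1,
        toPTree_share hβ y₀ t h.2.1]
      have hrs := (r_pos hβ s h.1).ne'
      have hrt := (r_pos hβ t h.2.1).ne'
      have hP : Sched.anchor β (Sched.node s t) + β * Sched.legMass β (Sched.node s t) =
          (Sched.anchor β s + β * Sched.legMass β s) * (Sched.anchor β t + β * Sched.legMass β t) := by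
        rw [legMass_node, (qp_node β s t).1]; ring
      rw [hP, tailMass_two, tailMass_two, tailMass_two, legMass_node, narrowMass_node]
      unfold Sched.share
      field_simp
      ring

/-- The tree's deviation is the schedule's deviation. -/
theorem toPTree_dev {a β : ℝ} (hβ : 1 ≤ β) (y₀ : ℝ → ℝ) :
    ∀ s : Sched, Sched.Admissible a β s → PTree.dev β (toPTree β y₀ s) = Sched.dev β y₀ s
  | Sched.base b, _ => by simp [toPTree, PTree.dev, Sched.dev]
  | Sched.node s t, h => by
      simp only [toPTree, PTree.dev, Sched.dev]
      rw [toPTree_dev hβ y₀ s h.1, toPTree_dev hβ y₀ t h.2.1, toPTree_share hβ y₀ s h.1,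
        toPTree_share hβ y₀ t h.2.1]

/-- The tree's size is the schedule's log-size. -/
theorem toPTree_size (β : ℝ) (y₀ : ℝ → ℝ) :
    ∀ s : Sched, PTree.size (toPTree β y₀ s) = Sched.logSize β s
  | Sched.base b => by simp [toPTree, PTree.size, Sched.logSize]
  | Sched.node s t => by
      simp only [toPTree, PTree.size, Sched.logSize]
      rw [toPTree_size β y₀ s, toPTree_size β y₀ t]

/-! ## Admissible schedules are admissible trees -/

/-- **Admissible schedule ↦ admissible tree.**  Let `1 < β`, `1 ≤ a`, `0 ≤ V_min` with
`β ≤ (1 − V_min)(2 − a^{-2})`, `0 ≤ R`, base deviations `0 ≤ y₀ b ≤ R/(b+β)` for `b ≥ 0`.  Then every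
admissible schedule over heavy bases maps to an admissible product tree of kernel XLI-A with floor
`V_min` and minimal base size `log(2β−1)`. -/
theorem toPTree_adm {a β Vmin R : ℝ} (hβ : 1 < β) (ha : 1 ≤ a) (hV0 : 0 ≤ Vmin)
    (hfloor : β ≤ (1 - Vmin) * (2 - a⁻¹ ^ 2)) (hR : 0 ≤ R) {y₀ : ℝ → ℝ}
    (hy : ∀ b : ℝ, 0 ≤ b → 0 ≤ y₀ b ∧ y₀ b ≤ R / (b + β)) :
    ∀ s : Sched, Sched.Admissible a β s → HeavyBases β s →
      PTree.Adm β Vmin R (Real.log (2 * β - 1)) (toPTree β y₀ s)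
  | Sched.base b, h, hh => by
      have hb : 0 ≤ b := h.1
      have hhb : β - 1 ≤ b := hh
      have hbβ : 0 < b + β := by linarith
      obtain ⟨hy0, hy1⟩ := hy b hb
      show 0 < 1 / (b + β) ∧ (2 * β - 1) * (1 / (b + β)) ≤ 1 ∧ 0 ≤ y₀ b ∧ y₀ b ≤ R * (1 / (b + β)) ∧
        Real.log (2 * β - 1) ≤ Real.log (b + β)
      refine ⟨by positivity, ?_, hy0, by rw [mul_one_div]; exact hy1, ?_⟩
      · rw [mul_one_div, div_le_one hbβ]; linarith
      · exact Real.log_le_log (by linarith) (by linarith)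
  | Sched.node s t, h, hh => by
      refine ⟨toPTree_adm hβ ha hV0 hfloor hR hy s h.1 hh.1,
        toPTree_adm hβ ha hV0 hfloor hR hy t h.2.1 hh.2, ?_⟩
      -- the depth-2 node floor
      have hfl := h.2.2 2 (by norm_num)
      have hr := r_pos hβ.le (Sched.node s t) h
      obtain ⟨_, hL⟩ := anchor_nonneg_legMass_pos hβ.le (Sched.node s t) h
      show PTree.wide β (toPTree β y₀ (Sched.node s t)) ≤
        (1 - Vmin) * PTree.share β (toPTree β y₀ (Sched.node s t))
      rw [toPTree_wide hβ.le y₀ (Sched.node s t) h, toPTree_share hβ.le y₀ (Sched.node s t) h]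
      unfold Sched.share
      rw [← mul_div_assoc, div_le_div_iff_of_pos_right hr]
      -- T₂ ≤ (1 − V_min)·L from (2 − a⁻²)·T₂ ≤ β·L ≤ (1−V_min)(2 − a⁻²)·L
      have ha2 : a⁻¹ ^ 2 ≤ 1 := by
        have : a⁻¹ ≤ 1 := inv_le_one_of_one_le₀ ha
        have h0 : 0 ≤ a⁻¹ := inv_nonneg.2 (by linarith)
        nlinarith
      have hc : 0 < 2 - a⁻¹ ^ 2 := by linarith
      set T := Sched.tailMass β (Sched.node s t) 2 with hT
      set L := Sched.legMass β (Sched.node s t) with hLdef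
      by_cases hTn : T ≤ 0
      · have : 0 ≤ (1 - Vmin) * L := by
          have h1V : 0 ≤ 1 - Vmin := by nlinarith
          positivity
        linarith
      · push Not at hTn
        have h1 : (2 - a⁻¹ ^ 2) * T ≤ (1 - Vmin) * (2 - a⁻¹ ^ 2) * L := by
          calc (2 - a⁻¹ ^ 2) * T ≤ β * L := hfl
            _ ≤ (1 - Vmin) * (2 - a⁻¹ ^ 2) * L := mul_le_mul_of_nonneg_right hfloor hL.le
        have h2 : (2 - a⁻¹ ^ 2) * T ≤ (2 - a⁻¹ ^ 2) * ((1 - Vmin) * L) := by linarith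
        exact le_of_mul_le_mul_left h2 hc

/-! ## The cap on all schedules at `β = 3/2` -/

/-- **ASKS (i) for the β = 3/2 dial, heavy bases (model level).**  For every width `a ≥ 2`, every
`R ≥ 0` and base deviations `0 ≤ y₀ b ≤ R/(b + 3/2)`, along EVERY admissible schedule of kernel XL-D
over heavy bases (`b ≥ 1/2`):
`dev (3/2) y₀ s ≤ (101/2)·R/(log 2)^{κ_S} · (logSize (3/2) s)^{κ_S}`, `κ_S = log₂(4/3)` —
no floor-respecting schedule, chain or tree, amplifies the first-order deviation faster than
Schönhage's order. -/
theorem sched_cap_three_halves {a R : ℝ} (ha : 2 ≤ a) (hR : 0 ≤ R) {y₀ : ℝ → ℝ}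
    (hy : ∀ b : ℝ, 0 ≤ b → 0 ≤ y₀ b ∧ y₀ b ≤ R / (b + 3 / 2)) (s : Sched)
    (hs : Sched.Admissible a (3 / 2) s) (hh : HeavyBases (3 / 2) s) :
    Sched.dev (3 / 2) y₀ s ≤
      101 / 2 * R / Real.log 2 ^ (Real.log (4 / 3) / Real.log 2) *
        Sched.logSize (3 / 2) s ^ (Real.log (4 / 3) / Real.log 2) := by
  have ha2 : a⁻¹ ^ 2 ≤ 1 / 4 := by
    have h1 : a⁻¹ ≤ 1 / 2 := by
      rw [inv_le_comm₀ (by linarith) (by norm_num)]; norm_num; linarith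
    have h0 : 0 ≤ a⁻¹ := inv_nonneg.2 (by linarith)
    nlinarith
  have hfloor : (3 / 2 : ℝ) ≤ (1 - 1 / 7) * (2 - a⁻¹ ^ 2) := by linarith
  have hT := toPTree_adm (β := 3 / 2) (Vmin := 1 / 7) (by norm_num) (by linarith) (by norm_num)
    hfloor hR hy s hs hh
  have hlog : Real.log (2 * (3 / 2 : ℝ) - 1) = Real.log 2 := by norm_num
  rw [hlog] at hT
  have h := tree_cap_three_halves_uniform hR (Real.log_pos (by norm_num)) (toPTree (3 / 2) y₀ s) hT
  rw [toPTree_dev (by norm_num) y₀ s hs, toPTree_size] at h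
  exact h

end Summit.MatrixMultiplication.MatrixMultiplication.Theorems.FarEdgeDescentTreeCapBridge
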